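import Literature.Barriers.QuantumAdvantage.TensorNetworkContractionPathDecomposition
import Literature.Computability.Complexity.CodeFP
import HarnessLib

/-!
# Barrier catalogue `QuantumAdvantage` — the bags of the path decomposition as lists of node codes

Companion to `TensorNetworkContractionPathDecomposition.lean` (`pathDecomp σ C`: the rooted path
decomposition of the circuit graph under a wire ordering, bags `bagAt C σ i j`). A machine handed
the description of the circuit (the wire lists of its gates) and the ordering (the list of
positions `[σ 0, …, σ (N-1)]`) prints `RootedTreeDecomposition.encode (pathDecomp σ C)`: the
parent list `[0, 0, 1, …, k-2]` and, bag by bag, the increasing list of the codes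
(`CircuitNode.code`) of its nodes. This file defines those lists by elementary list operations
on that data and proves they are the codes of the bags:

* `wireListOf g` (the wires of a gate in embedding order; `mem_wires_iff`), positions read off
  the position list (`posOf`), `gMin` / `gMax` and `crosses_iff` (a gate crosses the cut after
  `i` iff its least position is `≤ i` and its largest is `> i`), `crossCodes` = the codes of
  `crossNodes` (`mem_crossCodes_iff`);
* the two nodes of a wire around a time boundary, explicitly: `lastCode`, `firstCode`
  (`lastBefore_iff`, `firstAfter_iff`, `mem_around_iff_code`);
* `sortDedup` (insertion into an increasing list), `bagCodes pos N wl i j` and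
  **`mem_bagCodes_iff`** / **`bagCodes_eq_sort`**: `bagCodes` is the increasing list of the codes
  of `bagAt C σ ⟨i⟩ j`;
* **`encode_pathDecomp`**: the code of `pathDecomp σ C` is the pair code of the parent list
  `(range k).map (· - 1)` and of the bag lists `bagCodes … i j` in lexicographic order.

## References

* [MarkovShi2008] I. L. Markov, Y. Shi, SIAM J. Comput. 38 (2008) 963–981, §5 (proof of Prop 5.1).
* [AroraBarak2009] S. Arora, B. Barak, *Computational Complexity*, CUP 2009, §0.1 (codes of lists).
-/

noncomputable section

namespace Literature.Barriers.QuantumAdvantage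

open Literature.Computability.Cryptography Literature.Combinatorics.SimpleGraph
  Literature.Computability.Complexity.CodeFP Computability

variable {G : QGateSet} {N : ℕ}

/-! ### Wire lists and positions -/

/-- **The wire list of a gate** in embedding order (the list written in its code). [folklore] -/
def wireListOf : QGate G N → List ℕ
  | .gate _ e => List.ofFn fun i => ((e i : Fin N) : ℕ)
  | .oracle _ e => List.ofFn fun i => ((e i : Fin N) : ℕ)

/-- A wire carries a gate iff its index is in the wire list. [folklore] -/
theorem mem_wires_iff {g : QGate G N} {w : Fin N} : w ∈ g.wires ↔ (w : ℕ) ∈ wireListOf g := by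
  cases g with
  | gate op e =>
    simp only [QGate.wires, Finset.mem_map, Finset.mem_univ, true_and, wireListOf, List.mem_ofFn]
    constructor
    · rintro ⟨i, rfl⟩; exact ⟨i, rfl⟩
    · rintro ⟨i, hi⟩; exact ⟨i, Fin.ext hi⟩
  | oracle k e =>
    simp only [QGate.wires, Finset.mem_map, Finset.mem_univ, true_and, wireListOf, List.mem_ofFn]
    constructor
    · rintro ⟨i, rfl⟩; exact ⟨i, rfl⟩
    · rintro ⟨i, hi⟩; exact ⟨i, Fin.ext hi⟩

/-- Entries of a wire list are wire indices. [folklore] -/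
theorem lt_of_mem_wireListOf {g : QGate G N} {w : ℕ} (h : w ∈ wireListOf g) : w < N := by
  cases g <;> (simp only [wireListOf, List.mem_ofFn] at h; obtain ⟨i, rfl⟩ := h; exact Fin.isLt _)

/-- The position of wire `w` read off the position list `[σ 0, …, σ (N-1)]`. [folklore] -/
def posOf (pos : List ℕ) (w : ℕ) : ℕ := pos.getD w 0

/-- The position list of an ordering. [folklore] -/
def posList (σ : Fin N ≃ Fin N) : List ℕ := List.ofFn fun w => ((σ w : Fin N) : ℕ)

/-- Reading the position list. [folklore] -/
theorem posOf_posList (σ : Fin N ≃ Fin N) (w : Fin N) : posOf (posList σ) w = ((σ w : Fin N) : ℕ) := by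
  unfold posOf posList
  rw [List.getD_eq_getElem?_getD, List.getElem?_ofFn]
  simp [w.isLt]

/-- The wire at position `i`: its index in the position list. [folklore] -/
def wireAt (pos : List ℕ) (i : ℕ) : ℕ := pos.idxOf i

/-- The wire at position `i` is `σ⁻¹ i`. [folklore] -/
theorem wireAt_posList (σ : Fin N ≃ Fin N) (i : Fin N) : wireAt (posList σ) i = ((σ.symm i : Fin N) : ℕ) := by
  unfold wireAt posList
  have hnd : (List.ofFn fun w : Fin N => ((σ w : Fin N) : ℕ)).Nodup :=
    List.nodup_ofFn_ofInjective fun a b h => σ.injective (Fin.ext h)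
  have hk : ((σ.symm i : Fin N) : ℕ) < (List.ofFn fun w : Fin N => ((σ w : Fin N) : ℕ)).length := by
    rw [List.length_ofFn]; exact Fin.isLt _
  have hval : (List.ofFn fun w : Fin N => ((σ w : Fin N) : ℕ))[((σ.symm i : Fin N) : ℕ)] = (i : ℕ) := by
    rw [List.getElem_ofFn]; simp
  conv_lhs => rw [← hval]
  exact hnd.idxOf_getElem _ hk

/-! ### Crossing gates -/

/-- The least position of a gate (`N` if it has no wires). [folklore] -/
def gMin (pos : List ℕ) (N : ℕ) (ws : List ℕ) : ℕ := (ws.map (posOf pos)).foldr min N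

/-- The largest position of a gate (`0` if it has no wires). [folklore] -/
def gMax (pos : List ℕ) (ws : List ℕ) : ℕ := (ws.map (posOf pos)).foldr max 0

/-- `gMin ≤ i` iff some wire has position `≤ i` (for `i < N`). [folklore] -/
theorem gMin_le_iff {pos : List ℕ} {N i : ℕ} (hi : i < N) :
    ∀ ws : List ℕ, gMin pos N ws ≤ i ↔ ∃ w ∈ ws, posOf pos w ≤ i
  | [] => by simp [gMin]; omega
  | w :: ws => by
    have ih := gMin_le_iff (pos := pos) hi ws
    simp only [gMin, List.map_cons, List.foldr_cons, min_le_iff, List.mem_cons, exists_eq_or_imp] at ih ⊢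
    exact or_congr_right ih

/-- `i < gMax` iff some wire has position `> i`. [folklore] -/
theorem lt_gMax_iff {pos : List ℕ} {i : ℕ} : ∀ ws : List ℕ, i < gMax pos ws ↔ ∃ w ∈ ws, i < posOf pos w
  | [] => by simp [gMax]
  | w :: ws => by
    have ih := lt_gMax_iff (pos := pos) (i := i) ws
    simp only [gMax, List.map_cons, List.foldr_cons, lt_max_iff, List.mem_cons, exists_eq_or_imp] at ih ⊢
    exact or_congr_right ih

/-- **A gate crosses the cut after `i` iff `gMin ≤ i < gMax`** on its wire list. [cite: MarkovShi2008, §5 (Prop 5.1)] -/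
theorem crosses_iff (σ : Fin N ≃ Fin N) {i : ℕ} (hi : i < N) (g : QGate G N) :
    Crosses σ i g ↔ gMin (posList σ) N (wireListOf g) ≤ i ∧ i < gMax (posList σ) (wireListOf g) := by
  rw [gMin_le_iff hi, lt_gMax_iff]
  unfold Crosses
  constructor
  · rintro ⟨⟨j, hj, hji⟩, ⟨j', hj', hij'⟩⟩
    exact ⟨⟨j, mem_wires_iff.1 hj, by rwa [posOf_posList]⟩, ⟨j', mem_wires_iff.1 hj', by rwa [posOf_posList]⟩⟩
  · rintro ⟨⟨w, hw, hwi⟩, ⟨w', hw', hiw'⟩⟩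
    have hwN := lt_of_mem_wireListOf hw
    have hw'N := lt_of_mem_wireListOf hw'
    refine ⟨⟨⟨w, hwN⟩, mem_wires_iff.2 hw, ?_⟩, ⟨⟨w', hw'N⟩, mem_wires_iff.2 hw', ?_⟩⟩
    · rwa [posOf_posList σ ⟨w, hwN⟩] at hwi
    · rwa [posOf_posList σ ⟨w', hw'N⟩] at hiw'

/-- **The codes of the gates crossing the cut after `i`** (increasing): gate `t ↦ N + t`.
[cite: MarkovShi2008, §5 (proof of Prop 5.1: the bag B_i)] -/
def crossCodes (pos : List ℕ) (N : ℕ) (wl : List (List ℕ)) (i : ℕ) : List ℕ :=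
  ((List.range wl.length).filter fun t => decide (gMin pos N (wl.getD t []) ≤ i ∧ i < gMax pos (wl.getD t []))).map (N + ·)

/-- Membership in `crossCodes`: the codes of `crossNodes`. [folklore] -/
theorem mem_crossCodes_iff (σ : Fin N ≃ Fin N) (C : QCircuit G N) {i : ℕ} (hi : i < N) (c : ℕ) :
    c ∈ crossCodes (posList σ) N (C.gates.map wireListOf) i ↔ ∃ u ∈ crossNodes C σ i, u.code = c := by
  simp only [crossCodes, List.mem_map, List.mem_filter, List.mem_range, List.length_map, decide_eq_true_eq]
  constructor
  · rintro ⟨t, ⟨ht, hcross⟩, rfl⟩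
    refine ⟨.gate ⟨t, ht⟩, gate_mem_crossNodes.2 ?_, rfl⟩
    rw [crosses_iff σ hi]
    rwa [List.getD_eq_getElem?_getD, List.getElem?_map, List.getElem?_eq_getElem ht, Option.map_some, Option.getD_some] at hcross
  · rintro ⟨u, hu, rfl⟩
    obtain ⟨t, rfl, hcross⟩ := mem_crossNodes.1 hu
    refine ⟨t, ⟨t.isLt, ?_⟩, rfl⟩
    rw [crosses_iff σ hi] at hcross
    rwa [List.getD_eq_getElem?_getD, List.getElem?_map, List.getElem?_eq_getElem t.isLt, Option.map_some, Option.getD_some]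

/-! ### The nodes of a wire around a time boundary -/

/-- The gates (positions in the gate list) acting on wire `w`, increasing. [folklore] -/
def gateTimesOn (wl : List (List ℕ)) (w : ℕ) : List ℕ := (List.range wl.length).filter fun t => decide (w ∈ wl.getD t [])

/-- **The code of the last node of wire `w` with time stamp `≤ j`**: the last gate `t` on `w` with
`t + 1 ≤ j` (code `N + t`), else the input of `w` (code `w`). [folklore] -/
def lastCode (N : ℕ) (wl : List (List ℕ)) (w j : ℕ) : ℕ :=
  match ((gateTimesOn wl w).filter fun t => decide (t + 1 ≤ j)).getLast? with
  | some t => N + t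
  | none => w

/-- **The code of the first node of wire `w` with time stamp `> j`**: the first gate `t` on `w`
with `j < t + 1` (code `N + t`), else the output of `w` (code `N + T + w`). [folklore] -/
def firstCode (N : ℕ) (wl : List (List ℕ)) (w j : ℕ) : ℕ :=
  match ((gateTimesOn wl w).filter fun t => decide (j < t + 1)).head? with
  | some t => N + t
  | none => N + wl.length + w

section Around

variable (C : QCircuit G N)

/-- The wire lists of the circuit. [folklore] -/
abbrev wlOf (C : QCircuit G N) : List (List ℕ) := C.gates.map wireListOf

/-- Reading the wire list of gate `t`. [folklore] -/
theorem wlOf_getD {C : QCircuit G N} {t : ℕ} (ht : t < C.gates.length) : (wlOf C).getD t [] = wireListOf C.gates[t] := by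
  rw [List.getD_eq_getElem?_getD, List.getElem?_map, List.getElem?_eq_getElem ht, Option.map_some, Option.getD_some]

/-- A gate lies on wire `w` iff `w` is in its wire list. [folklore] -/
theorem onWire_gate_iff {C : QCircuit G N} {w : Fin N} {t : Fin C.gates.length} :
    OnWire C w (.gate t) ↔ (w : ℕ) ∈ (wlOf C).getD t [] := by
  rw [wlOf_getD t.isLt]; exact mem_wires_iff

/-- Membership in `gateTimesOn`. [folklore] -/
theorem mem_gateTimesOn_iff {C : QCircuit G N} {w : Fin N} {t : ℕ} :
    t ∈ gateTimesOn (wlOf C) w ↔ ∃ h : t < C.gates.length, OnWire C w (.gate ⟨t, h⟩) := by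
  simp only [gateTimesOn, List.mem_filter, List.mem_range, List.length_map, decide_eq_true_eq]
  constructor
  · rintro ⟨ht, hw⟩; exact ⟨ht, onWire_gate_iff.2 hw⟩
  · rintro ⟨ht, hw⟩; exact ⟨ht, onWire_gate_iff.1 hw⟩

/-- A filtered range is strictly increasing. [folklore] -/
theorem pairwise_lt_filter_range (n : ℕ) (p : ℕ → Bool) : ((List.range n).filter p).Pairwise (· < ·) :=
  List.Pairwise.filter p List.pairwise_lt_range

/-- The last element of a filtered range is its maximum. [folklore] -/
theorem le_of_getLast?_filter {l : List ℕ} (hl : l.Pairwise (· < ·)) {m : ℕ} (h : l.getLast? = some m) {t : ℕ} (ht : t ∈ l) :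
    t ≤ m := by
  obtain ⟨l', rfl⟩ := List.getLast?_eq_some_iff.1 h
  rw [List.pairwise_append] at hl
  rcases List.mem_append.1 ht with h' | h'
  · exact (hl.2.2 t h' m (List.mem_singleton_self m)).le
  · rw [List.mem_singleton.1 h']

/-- The head of a filtered range is its minimum. [folklore] -/
theorem le_of_head?_filter {l : List ℕ} (hl : l.Pairwise (· < ·)) {m : ℕ} (h : l.head? = some m) {t : ℕ} (ht : t ∈ l) :
    m ≤ t := by
  obtain ⟨l', rfl⟩ := List.head?_eq_some_iff.1 h
  rw [List.pairwise_cons] at hl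
  rcases List.mem_cons.1 ht with rfl | h'
  · exact le_rfl
  · exact (hl.1 t h').le

variable {C}

/-- **The last node with stamp `≤ j` has code `lastCode`** (`j ≤ T`). [folklore] -/
theorem code_of_lastBefore {w : Fin N} {j : ℕ} (hj : j ≤ C.gates.length) {u : CircuitNode C.gates.length N}
    (hu : LastBefore C w j u) : u.code = lastCode N (wlOf C) w j := by
  obtain ⟨hon, hpos, hmax⟩ := hu
  set S := (gateTimesOn (wlOf C) w).filter fun t => decide (t + 1 ≤ j) with hS
  have hSmem : ∀ {t : ℕ}, t ∈ S ↔ ∃ h : t < C.gates.length, OnWire C w (.gate ⟨t, h⟩) ∧ t + 1 ≤ j := by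
    intro t; rw [hS, List.mem_filter, mem_gateTimesOn_iff, decide_eq_true_eq]
    exact ⟨fun ⟨⟨h, ho⟩, hle⟩ => ⟨h, ho, hle⟩, fun ⟨h, ho, hle⟩ => ⟨⟨h, ho⟩, hle⟩⟩
  have hSpw : S.Pairwise (· < ·) := (pairwise_lt_filter_range _ _).filter _
  unfold lastCode
  rw [← hS]
  rcases hlast : S.getLast? with _ | m
  · -- no gate on `w` before `j`: the input
    have hSnil : S = [] := List.getLast?_eq_none_iff.1 hlast
    cases u with
    | input w' => simp only [OnWire] at hon; subst hon; rfl
    | gate t =>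
      exfalso
      have : (t : ℕ) ∈ S := hSmem.2 ⟨t.isLt, hon, hpos⟩
      rw [hSnil] at this; simp at this
    | output w' =>
      exfalso; change C.gates.length + 1 ≤ j at hpos; omega
  · -- the last gate `m` on `w` with `m + 1 ≤ j`
    have hm : m ∈ S := List.mem_of_getLast? hlast
    obtain ⟨hmT, hmon, hmj⟩ := hSmem.1 hm
    have hge := hmax (.gate ⟨m, hmT⟩) hmon hmj
    change m + 1 ≤ u.pos at hge
    cases u with
    | input w' => exact absurd hge (by change ¬ (m + 1 ≤ 0); omega)
    | gate t =>
      have htS : (t : ℕ) ∈ S := hSmem.2 ⟨t.isLt, hon, hpos⟩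
      have h1 := le_of_getLast?_filter hSpw hlast htS
      change m + 1 ≤ (t : ℕ) + 1 at hge
      have : (t : ℕ) = m := by omega
      simp only [CircuitNode.code, this]
    | output w' => exfalso; change C.gates.length + 1 ≤ j at hpos; omega

/-- There is a last node with stamp `≤ j` (`j ≤ T`). [folklore] -/
theorem exists_lastBefore (w : Fin N) {j : ℕ} (_hj : j ≤ C.gates.length) : ∃ u, LastBefore C w j u := by
  set S := (gateTimesOn (wlOf C) w).filter fun t => decide (t + 1 ≤ j) with hS
  have hSmem : ∀ {t : ℕ}, t ∈ S ↔ ∃ h : t < C.gates.length, OnWire C w (.gate ⟨t, h⟩) ∧ t + 1 ≤ j := by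
    intro t; rw [hS, List.mem_filter, mem_gateTimesOn_iff, decide_eq_true_eq]
    exact ⟨fun ⟨⟨h, ho⟩, hle⟩ => ⟨h, ho, hle⟩, fun ⟨h, ho, hle⟩ => ⟨⟨h, ho⟩, hle⟩⟩
  have hSpw : S.Pairwise (· < ·) := (pairwise_lt_filter_range _ _).filter _
  rcases hlast : S.getLast? with _ | m
  · have hSnil : S = [] := List.getLast?_eq_none_iff.1 hlast
    refine ⟨.input w, rfl, Nat.zero_le _, fun z hz hzj => ?_⟩
    cases z with
    | input w' => exact le_rfl
    | gate t =>
      have : (t : ℕ) ∈ S := hSmem.2 ⟨t.isLt, hz, hzj⟩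
      rw [hSnil] at this; simp at this
    | output w' => change C.gates.length + 1 ≤ j at hzj; omega
  · have hm : m ∈ S := List.mem_of_getLast? hlast
    obtain ⟨hmT, hmon, hmj⟩ := hSmem.1 hm
    refine ⟨.gate ⟨m, hmT⟩, hmon, hmj, fun z hz hzj => ?_⟩
    cases z with
    | input w' => exact Nat.zero_le _
    | gate t =>
      have htS : (t : ℕ) ∈ S := hSmem.2 ⟨t.isLt, hz, hzj⟩
      have := le_of_getLast?_filter hSpw hlast htS
      change (t : ℕ) + 1 ≤ m + 1; omega
    | output w' => change C.gates.length + 1 ≤ j at hzj; omega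

/-- **The first node with stamp `> j` has code `firstCode`** (`j ≤ T`). [folklore] -/
theorem code_of_firstAfter {w : Fin N} {j : ℕ} (_hj : j ≤ C.gates.length) {u : CircuitNode C.gates.length N}
    (hu : FirstAfter C w j u) : u.code = firstCode N (wlOf C) w j := by
  obtain ⟨hon, hpos, hmin⟩ := hu
  set S := (gateTimesOn (wlOf C) w).filter fun t => decide (j < t + 1) with hS
  have hSmem : ∀ {t : ℕ}, t ∈ S ↔ ∃ h : t < C.gates.length, OnWire C w (.gate ⟨t, h⟩) ∧ j < t + 1 := by
    intro t; rw [hS, List.mem_filter, mem_gateTimesOn_iff, decide_eq_true_eq]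
    exact ⟨fun ⟨⟨h, ho⟩, hle⟩ => ⟨h, ho, hle⟩, fun ⟨h, ho, hle⟩ => ⟨⟨h, ho⟩, hle⟩⟩
  have hSpw : S.Pairwise (· < ·) := (pairwise_lt_filter_range _ _).filter _
  unfold firstCode
  rw [← hS]
  have hlen : (wlOf C).length = C.gates.length := List.length_map _
  rcases hhead : S.head? with _ | m
  · have hSnil : S = [] := List.head?_eq_none_iff.1 hhead
    cases u with
    | input w' => exfalso; change j < 0 at hpos; omega
    | gate t =>
      exfalso
      have : (t : ℕ) ∈ S := hSmem.2 ⟨t.isLt, hon, hpos⟩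
      rw [hSnil] at this; simp at this
    | output w' => simp only [OnWire] at hon; subst hon; simp [CircuitNode.code, hlen]
  · have hm : m ∈ S := List.mem_of_head? hhead
    obtain ⟨hmT, hmon, hmj⟩ := hSmem.1 hm
    have hle := hmin (.gate ⟨m, hmT⟩) hmon hmj
    change u.pos ≤ m + 1 at hle
    cases u with
    | input w' => exfalso; change j < 0 at hpos; omega
    | gate t =>
      have htS : (t : ℕ) ∈ S := hSmem.2 ⟨t.isLt, hon, hpos⟩
      have h1 := le_of_head?_filter hSpw hhead htS
      change (t : ℕ) + 1 ≤ m + 1 at hle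
      have : (t : ℕ) = m := by omega
      simp only [CircuitNode.code, this]
    | output w' =>
      exfalso
      change C.gates.length + 1 ≤ m + 1 at hle
      omega

/-- There is a first node with stamp `> j` (`j ≤ T`). [folklore] -/
theorem exists_firstAfter (w : Fin N) {j : ℕ} (hj : j ≤ C.gates.length) : ∃ u, FirstAfter C w j u := by
  set S := (gateTimesOn (wlOf C) w).filter fun t => decide (j < t + 1) with hS
  have hSmem : ∀ {t : ℕ}, t ∈ S ↔ ∃ h : t < C.gates.length, OnWire C w (.gate ⟨t, h⟩) ∧ j < t + 1 := by
    intro t; rw [hS, List.mem_filter, mem_gateTimesOn_iff, decide_eq_true_eq]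
    exact ⟨fun ⟨⟨h, ho⟩, hle⟩ => ⟨h, ho, hle⟩, fun ⟨h, ho, hle⟩ => ⟨⟨h, ho⟩, hle⟩⟩
  have hSpw : S.Pairwise (· < ·) := (pairwise_lt_filter_range _ _).filter _
  rcases hhead : S.head? with _ | m
  · have hSnil : S = [] := List.head?_eq_none_iff.1 hhead
    refine ⟨.output w, rfl, (by change j < C.gates.length + 1; omega), fun z hz hzj => ?_⟩
    cases z with
    | input w' => exfalso; change j < 0 at hzj; omega
    | gate t =>
      have : (t : ℕ) ∈ S := hSmem.2 ⟨t.isLt, hz, hzj⟩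
      rw [hSnil] at this; simp at this
    | output w' => exact le_rfl
  · have hm : m ∈ S := List.mem_of_head? hhead
    obtain ⟨hmT, hmon, hmj⟩ := hSmem.1 hm
    refine ⟨.gate ⟨m, hmT⟩, hmon, hmj, fun z hz hzj => ?_⟩
    cases z with
    | input w' => exfalso; change j < 0 at hzj; omega
    | gate t =>
      have htS : (t : ℕ) ∈ S := hSmem.2 ⟨t.isLt, hz, hzj⟩
      have := le_of_head?_filter hSpw hhead htS
      change m + 1 ≤ (t : ℕ) + 1; omega
    | output w' => change m + 1 ≤ C.gates.length + 1; omega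

/-- **The codes of the nodes around a boundary** (`j ≤ T`). [folklore] -/
theorem exists_mem_around_iff {w : Fin N} {j : ℕ} (hj : j ≤ C.gates.length) (c : ℕ) :
    (∃ u ∈ around C w j, u.code = c) ↔ c = lastCode N (wlOf C) w j ∨ c = firstCode N (wlOf C) w j := by
  constructor
  · rintro ⟨u, hu, rfl⟩
    rcases mem_around.1 hu with h | h
    · exact Or.inl (code_of_lastBefore hj h)
    · exact Or.inr (code_of_firstAfter hj h)
  · rintro (rfl | rfl)
    · obtain ⟨u, hu⟩ := exists_lastBefore w hj
      exact ⟨u, mem_around.2 (Or.inl hu), code_of_lastBefore hj hu⟩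
    · obtain ⟨u, hu⟩ := exists_firstAfter w hj
      exact ⟨u, mem_around.2 (Or.inr hu), code_of_firstAfter hj hu⟩

end Around

/-! ### Sorted lists of codes and the bags -/

/-- Insertion into an increasing list (no repetition). [folklore] -/
def insSD (acc : List ℕ) (x : ℕ) : List ℕ := acc.filter (fun c => decide (c < x)) ++ x :: acc.filter (fun c => decide (x < c))

/-- **Sorting with removal of repetitions** (insertion sort). [folklore] -/
def sortDedup (l : List ℕ) : List ℕ := l.foldl insSD []

/-- Insertion keeps the list increasing and adds the element. [folklore] -/
theorem insSD_spec {acc : List ℕ} (hacc : acc.Pairwise (· < ·)) (x : ℕ) :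
    (insSD acc x).Pairwise (· < ·) ∧ ∀ c, c ∈ insSD acc x ↔ c = x ∨ c ∈ acc := by
  refine ⟨?_, fun c => ?_⟩
  · rw [insSD, List.pairwise_append, List.pairwise_cons]
    refine ⟨hacc.filter _, ⟨fun c hc => ?_, hacc.filter _⟩, fun a ha b hb => ?_⟩
    · simpa using (List.mem_filter.1 hc).2
    · have ha' : a < x := by simpa using (List.mem_filter.1 ha).2
      rcases List.mem_cons.1 hb with rfl | hb
      · exact ha'
      · have hb' : x < b := by simpa using (List.mem_filter.1 hb).2
        exact ha'.trans hb'
  · simp only [insSD, List.mem_append, List.mem_filter, List.mem_cons, decide_eq_true_eq]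
    constructor
    · rintro (⟨h, -⟩ | rfl | ⟨h, -⟩)
      · exact Or.inr h
      · exact Or.inl rfl
      · exact Or.inr h
    · rintro (rfl | h)
      · exact Or.inr (Or.inl rfl)
      · rcases lt_trichotomy c x with hlt | rfl | hgt
        · exact Or.inl ⟨h, hlt⟩
        · exact Or.inr (Or.inl rfl)
        · exact Or.inr (Or.inr ⟨h, hgt⟩)

/-- `sortDedup` along a prefix. [folklore] -/
theorem foldl_insSD_spec : ∀ (l acc : List ℕ), acc.Pairwise (· < ·) →
    (l.foldl insSD acc).Pairwise (· < ·) ∧ ∀ c, c ∈ l.foldl insSD acc ↔ c ∈ l ∨ c ∈ acc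
  | [], acc, h => ⟨h, fun c => by simp⟩
  | x :: l, acc, h => by
    obtain ⟨h1, h2⟩ := insSD_spec h x
    obtain ⟨h3, h4⟩ := foldl_insSD_spec l _ h1
    refine ⟨h3, fun c => ?_⟩
    rw [List.foldl_cons, h4, h2, List.mem_cons]
    tauto

/-- **`sortDedup l` is increasing and has the elements of `l`.** [folklore] -/
theorem sortDedup_spec (l : List ℕ) : (sortDedup l).Pairwise (· < ·) ∧ ∀ c, c ∈ sortDedup l ↔ c ∈ l := by
  obtain ⟨h1, h2⟩ := foldl_insSD_spec l [] List.Pairwise.nil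
  exact ⟨h1, fun c => by rw [sortDedup, h2]; simp⟩

/-- **The bag at `(i, j)` as an increasing list of node codes**: the crossing gates of the cuts
after `i` and after `i - 1`, and the two nodes of the wire at position `i` around `j`.
[cite: MarkovShi2008, §5 (proof of Prop 5.1)] -/
def bagCodes (pos : List ℕ) (N : ℕ) (wl : List (List ℕ)) (i j : ℕ) : List ℕ :=
  sortDedup (crossCodes pos N wl i ++ crossCodes pos N wl (i - 1) ++
    [lastCode N wl (wireAt pos i) j, firstCode N wl (wireAt pos i) j])

/-- **Membership in `bagCodes`: the codes of the bag.** [folklore] -/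
theorem mem_bagCodes_iff (σ : Fin N ≃ Fin N) (C : QCircuit G N) {i : ℕ} (hi : i < N) {j : ℕ} (hj : j ≤ C.gates.length) (c : ℕ) :
    c ∈ bagCodes (posList σ) N (wlOf C) i j ↔ ∃ u ∈ bagAt C σ ⟨i, hi⟩ j, u.code = c := by
  rw [bagCodes, (sortDedup_spec _).2, List.mem_append, List.mem_append, mem_crossCodes_iff σ C hi,
    mem_crossCodes_iff σ C (i := i - 1) (by omega), wireAt_posList σ ⟨i, hi⟩]
  simp only [List.mem_cons, List.not_mem_nil, or_false]
  rw [← exists_mem_around_iff hj]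
  simp only [mem_bagAt]
  constructor
  · rintro ((⟨u, hu, rfl⟩ | ⟨u, hu, rfl⟩) | ⟨u, hu, rfl⟩)
    · exact ⟨u, Or.inl hu, rfl⟩
    · exact ⟨u, Or.inr (Or.inl hu), rfl⟩
    · exact ⟨u, Or.inr (Or.inr hu), rfl⟩
  · rintro ⟨u, (hu | hu | hu), rfl⟩
    · exact Or.inl (Or.inl ⟨u, hu, rfl⟩)
    · exact Or.inl (Or.inr ⟨u, hu, rfl⟩)
    · exact Or.inr ⟨u, hu, rfl⟩

/-- **`bagCodes` is the increasing code list of the bag.** [folklore] -/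
theorem bagCodes_eq_sort (σ : Fin N ≃ Fin N) (C : QCircuit G N) {i : ℕ} (hi : i < N) {j : ℕ} (hj : j ≤ C.gates.length) :
    bagCodes (posList σ) N (wlOf C) i j = ((bagAt C σ ⟨i, hi⟩ j).image CircuitNode.code).sort := by
  refine List.SortedLT.eq_of_mem_iff (List.sortedLT_iff_pairwise.2 (sortDedup_spec _).1) (Finset.sortedLT_sort _) fun c => ?_
  rw [mem_bagCodes_iff σ C hi hj, Finset.mem_sort, Finset.mem_image]

/-! ### The code of the path decomposition -/

/-- `List.ofFn` through the values. [folklore] -/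
theorem ofFn_eq_map_range {α : Type*} {k : ℕ} (g : ℕ → α) : List.ofFn (fun p : Fin k => g p) = (List.range k).map g := by
  rw [List.ofFn_eq_map, ← List.map_coe_finRange_eq_range, List.map_map]; rfl

/-- **The code of the path decomposition as lists**: the parent list `[0, 0, 1, …, k - 2]` and,
for `p < k = N (T + 1)`, the bag `bagCodes … (p / (T+1)) (p % (T+1))`, under the pair/list codes.
[cite: AroraBarak2009, §0.1 (codes of lists)] -/
theorem encode_pathDecomp (σ : Fin N ≃ Fin N) (C : QCircuit G N) (hN : 0 < N) (hC : ∀ g ∈ C.gates, g.wires.Nonempty) :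
    (pathDecomp σ C hN hC).encode =
      pairE (listE natE) (listE (listE natE))
        ((List.range (N * (C.gates.length + 1))).map (fun p => p - 1),
         (List.range (N * (C.gates.length + 1))).map fun p =>
           bagCodes (posList σ) N (wlOf C) (p / (C.gates.length + 1)) (p % (C.gates.length + 1))) := by
  rw [RootedTreeDecomposition.encode, pairE_eq, listE_eq, listE_eq, listE_eq, natE_eq]
  congr 1
  refine Prod.ext ?_ ?_
  · show (List.ofFn fun i => (((pathDecomp σ C hN hC).parent i : Fin _) : ℕ)) = _
    exact ofFn_eq_map_range (k := N * (C.gates.length + 1)) (fun p => p - 1)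
  · show (List.ofFn fun i => (((pathDecomp σ C hN hC).bag i).image CircuitNode.code).sort) = _
    rw [← ofFn_eq_map_range (k := N * (C.gates.length + 1))
      (fun p => bagCodes (posList σ) N (wlOf C) (p / (C.gates.length + 1)) (p % (C.gates.length + 1)))]
    congr 1
    funext p
    exact (bagCodes_eq_sort σ C (div_lt_of_lt_mul p.isLt) (Nat.lt_succ_iff.1 (Nat.mod_lt _ (Nat.succ_pos _)))).symm

end Literature.Barriers.QuantumAdvantage

end
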